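import Literature.NumberTheory.LFunctions.KMVAfeKernelMellin
import Literature.NumberTheory.LFunctions.KMVAfeWeightDecay
import Mathlib.Analysis.MellinInversion
import Mathlib.Analysis.SpecialFunctions.ImproperIntegrals
import Mathlib.Analysis.SpecialFunctions.Integrability.Basic
import HarnessLib

/-!
# KMV 2000 (21)–(22): the all-order AFE weight in closed real form —
# `afeW q̂ i j n₁ n₂ = W_{ij}(log(q̂/n₁), log(q̂/n₂); n₁n₂/q̂²)` (the REAL-FORM BRIDGE)

Source: E. Kowalski, P. Michel, J. VanderKam, J. reine angew. Math. 526 (2000), (13) p. 9, (15) p. 9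
and (21)–(22) p. 12 [held: paper:doi-10-1515-crll-2000-074]. Cell landau-siegel / ls-inputs, line
H-AFE2 (K-INPUTS-11 (1)), seat ls-inputs-Hafe-lead g1: stub **T3** `stub_afeW_eq_logCutoffW` of the
fact skeleton `log-fricke-split` for `KMV2000.kmv2000_eq22` / `KMV2000.afeW_decay`. Proofs only.

With `c_ν = q̂/n_ν`, `a_ν = log c_ν`, `E_ν(x) = e^{−x}(a_ν + log x)^{i_ν}` and the TAIL
`J₂(z) = ∫_{x > z} E₂(x) dx`:

* §1 integrability of `x ↦ xᵗ E(x)` on `(0,∞)` (`Re t > −1`; from `KMVAfeKernelMellin` by `u = cx`);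
* §2 the tail `J₂`: bounded by `‖E₂‖₁`, continuous;
* §3 `𝓜J₂(t) = t⁻¹ ∫_0^∞ xᵗ E₂(x) dx` for `Re t > 0` (Fubini on `{0 < z < x}`), hence for the scaled tail
  `Ψ₂(v) = J₂(v/c₂)`: `𝓜Ψ₂(t) = D_j(q̂;n₂,t)/t` (`KMV2000.mellin_scaledTail_eq`);
* §4 **the bridge** `KMV2000.afeW_eq_logCutoffW`: `afeW q̂ i j n₁ n₂ = (1/2π)∫ D_i(t) 𝓜Ψ₂(t) dy`
  `= ∫_{x₁} E₁(x₁) · (1/2π)∫ (c₁x₁)ᵗ 𝓜Ψ₂(t) dy dx₁` (Fubini; `D_i(t) = ∫ (c₁x₁)ᵗ E₁(x₁) dx₁`)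
  `= ∫_{x₁} E₁(x₁) Ψ₂(1/(c₁x₁)) dx₁` (Mellin inversion on `Re t = 3`, Mathlib `mellinInv_mellin_eq`, the
  vertical integrability being `KMV2000.integrable_afeKernel_div_vertical`)
  `= ∫_{x₁} E₁(x₁) ∫_{x₂ > y₀/x₁} E₂(x₂) dx₂ dx₁ = logCutoffW i j a₁ a₂ y₀`, `y₀ = n₁n₂/q̂²`;
  and the registered quantifier shape `KMV2000.afeW_eq_logCutoffW_all` (= stub T3 verbatim).

At `i = j = 0` this is the tree's `afeW_zero_zero_eq_cutoffW`. No claim about Landau–Siegel zeros.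
-/

noncomputable section

open scoped Real
open Complex Set MeasureTheory Filter Asymptotics
open _root_.Topology

namespace Literature.NumberTheory.LFunctions.KMV2000

/-! ### §1 Integrability of `xᵗ e^{−x} (log c + log x)^j` -/

/-- For `c > 0`, `Re t > −1`: `x ↦ xᵗ e^{−x}(log c + log x)^j` is integrable on `(0,∞)` (the Mellin
convergence of `(log u)^j (u/c)e^{−u/c}` at `t`, `KMVAfeKernelMellin`, after `u = cx`).
[cite: KowalskiMichelVanderKam2000, (13) p. 9] -/
theorem integrableOn_cpow_mul_expLogPow {c : ℝ} (hc : 0 < c) (j : ℕ) {t : ℂ} (ht : -1 < t.re) :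
    IntegrableOn (fun x : ℝ ↦ (x : ℂ) ^ t *
      ((Real.exp (-x) * (Real.log c + Real.log x) ^ j : ℝ) : ℂ)) (Ioi 0) := by
  have hM := mellinConvergent_log_pow_kernel hc j ht
  rw [MellinConvergent] at hM
  -- `u = c x`
  have h2 := (integrableOn_Ioi_comp_mul_left_iff (fun u : ℝ ↦ (u : ℂ) ^ (t - 1) •
      ((((Real.log u) ^ j : ℝ)) • (((u / c * Real.exp (-(u / c))) : ℝ) : ℂ))) 0 hc).mpr
    (by rw [mul_zero]; exact hM)
  have h3 := h2.const_mul ((c : ℂ) ^ (1 - t))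
  refine IntegrableOn.congr_fun h3 (fun x hx ↦ ?_) measurableSet_Ioi
  have hx : (0 : ℝ) < x := hx
  have hc' : (c : ℂ) ≠ 0 := ofReal_ne_zero.mpr hc.ne'
  have hx' : (x : ℂ) ≠ 0 := ofReal_ne_zero.mpr hx.ne'
  have hcx : c * x / c = x := by field_simp
  simp only [Complex.real_smul, smul_eq_mul]
  rw [hcx, Real.log_mul hc.ne' hx.ne', Complex.ofReal_mul, Complex.mul_cpow_ofReal_nonneg hc.le hx.le]
  have e1 : (c : ℂ) ^ (1 - t) * (c : ℂ) ^ (t - 1) = 1 := by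
    rw [← Complex.cpow_add _ _ hc', show (1 - t) + (t - 1) = 0 by ring, Complex.cpow_zero]
  have e2 : (x : ℂ) ^ (t - 1) * (x : ℂ) = (x : ℂ) ^ t := by
    conv_rhs => rw [show t = (t - 1) + 1 by ring]
    rw [Complex.cpow_add _ _ hx', cpow_one]
  push_cast
  linear_combination ((x : ℂ) ^ (t - 1) * (((Real.log c : ℝ) : ℂ) + ((Real.log x : ℝ) : ℂ)) ^ j *
    (x : ℂ) * Complex.exp (-(x : ℂ))) * e1 +
    (((Real.log c : ℝ) : ℂ) + ((Real.log x : ℝ) : ℂ)) ^ j * Complex.exp (-(x : ℂ)) * e2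

/-- Real form: for `c > 0`, `σ > −1`, `x ↦ x^σ e^{−x}|log c + log x|^j` is integrable on `(0,∞)`.
[cite: KowalskiMichelVanderKam2000, (13) p. 9] -/
theorem integrableOn_rpow_mul_expLogPow {c : ℝ} (hc : 0 < c) (j : ℕ) {σ : ℝ} (hσ : -1 < σ) :
    IntegrableOn (fun x : ℝ ↦ x ^ σ * (Real.exp (-x) * |Real.log c + Real.log x| ^ j)) (Ioi 0) := by
  have h := (integrableOn_cpow_mul_expLogPow hc j (t := (σ : ℂ)) (by simpa using hσ)).norm
  refine IntegrableOn.congr_fun h (fun x hx ↦ ?_) measurableSet_Ioi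
  have hx : (0 : ℝ) < x := hx
  rw [norm_mul, Complex.norm_cpow_eq_rpow_re_of_pos hx, Complex.ofReal_re, Complex.norm_real,
    Real.norm_eq_abs, abs_mul, abs_of_pos (Real.exp_pos _), abs_pow]

/-- `E(x) = e^{−x}(log c + log x)^j` is integrable on `(0,∞)`. [cite: KowalskiMichelVanderKam2000, (13) p. 9] -/
theorem integrableOn_expLogPow {c : ℝ} (hc : 0 < c) (j : ℕ) :
    IntegrableOn (fun x : ℝ ↦ Real.exp (-x) * (Real.log c + Real.log x) ^ j) (Ioi 0) := by
  have h := (integrableOn_cpow_mul_expLogPow hc j (t := 0) (by simp)).norm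
  have h' : IntegrableOn (fun x : ℝ ↦ |Real.exp (-x) * (Real.log c + Real.log x) ^ j|) (Ioi 0) := by
    refine IntegrableOn.congr_fun h (fun x hx ↦ ?_) measurableSet_Ioi
    rw [Complex.cpow_zero, one_mul, Complex.norm_real, Real.norm_eq_abs]
  have hmeas : AEStronglyMeasurable (fun x : ℝ ↦ Real.exp (-x) * (Real.log c + Real.log x) ^ j)
      (volume.restrict (Ioi 0)) := by
    refine (ContinuousOn.mul (by fun_prop) ((ContinuousOn.pow ?_ j))).aestronglyMeasurable
      measurableSet_Ioi
    exact continuousOn_const.add (Real.continuousOn_log.mono fun x hx ↦ ne_of_gt hx)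
  exact (integrable_norm_iff hmeas).mp (h'.congr_fun (fun x _ ↦ (Real.norm_eq_abs _).symm)
    measurableSet_Ioi)

/-- `E` is continuous on `(0,∞)`. [cite: KowalskiMichelVanderKam2000, (13) p. 9] -/
theorem continuousOn_expLogPow (c : ℝ) (j : ℕ) :
    ContinuousOn (fun x : ℝ ↦ Real.exp (-x) * (Real.log c + Real.log x) ^ j) (Ioi 0) := by
  refine ContinuousOn.mul (by fun_prop) (ContinuousOn.pow ?_ j)
  exact continuousOn_const.add (Real.continuousOn_log.mono fun x hx ↦ ne_of_gt hx)

/-! ### §2 The tail `J(z) = ∫_{x > z} E(x) dx` -/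

/-- The tail is bounded by the `L¹` norm: `|∫_{x>z} E| ≤ ∫_0^∞ |E|` for `z ≥ 0`.
[cite: KowalskiMichelVanderKam2000, (22) p. 12] -/
theorem abs_tail_le {c : ℝ} (hc : 0 < c) (j : ℕ) {z : ℝ} (hz : 0 ≤ z) :
    |∫ x in Ioi z, Real.exp (-x) * (Real.log c + Real.log x) ^ j| ≤
      ∫ x in Ioi (0 : ℝ), |Real.exp (-x) * (Real.log c + Real.log x) ^ j| := by
  have hint := integrableOn_expLogPow hc j
  calc |∫ x in Ioi z, Real.exp (-x) * (Real.log c + Real.log x) ^ j|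
      ≤ ∫ x in Ioi z, |Real.exp (-x) * (Real.log c + Real.log x) ^ j| := by
        rw [← Real.norm_eq_abs]
        exact (norm_integral_le_integral_norm _).trans (le_of_eq rfl)
    _ ≤ ∫ x in Ioi (0 : ℝ), |Real.exp (-x) * (Real.log c + Real.log x) ^ j| :=
        setIntegral_mono_set hint.abs (ae_of_all _ fun x ↦ abs_nonneg _)
          (ae_of_all _ (Ioi_subset_Ioi hz))

/-- The tail is continuous at every `z₀ > 0` (`d/dz ∫_{x>z} E = −E(z)`).
[cite: KowalskiMichelVanderKam2000, (22) p. 12] -/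
theorem continuousAt_tail {c : ℝ} (hc : 0 < c) (j : ℕ) {z₀ : ℝ} (hz₀ : 0 < z₀) :
    ContinuousAt (fun z : ℝ ↦ ∫ x in Ioi z, Real.exp (-x) * (Real.log c + Real.log x) ^ j) z₀ := by
  set E : ℝ → ℝ := fun x : ℝ ↦ Real.exp (-x) * (Real.log c + Real.log x) ^ j with hE
  have hint : IntegrableOn E (Ioi 0) := integrableOn_expLogPow hc j
  -- near `z₀` the tail is `∫_{Ioi 0} E − ∫_{0..z} E`
  have hev : (fun z : ℝ ↦ ∫ x in Ioi z, E x) =ᶠ[𝓝 z₀]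
      fun z : ℝ ↦ (∫ x in Ioi (0 : ℝ), E x) - ∫ x in (0 : ℝ)..z, E x := by
    filter_upwards [Ioi_mem_nhds hz₀] with z hz
    have h := intervalIntegral.integral_Ioi_sub_Ioi hint (le_of_lt hz)
    linear_combination -h
  refine (ContinuousAt.congr ?_ hev.symm)
  have hprim : HasDerivAt (fun z : ℝ ↦ ∫ x in (0 : ℝ)..z, E x) (E z₀) z₀ := by
    have hii : IntervalIntegrable E volume 0 z₀ :=
      (intervalIntegrable_iff_integrableOn_Ioc_of_le hz₀.le).mpr (hint.mono_set Ioc_subset_Ioi_self)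
    have hcont : ContinuousOn E (Ioi 0) := continuousOn_expLogPow c j
    exact intervalIntegral.integral_hasDerivAt_right hii
      (hcont.stronglyMeasurableAtFilter isOpen_Ioi z₀ hz₀) (hcont.continuousAt (Ioi_mem_nhds hz₀))
  exact continuousAt_const.sub hprim.continuousAt

/-! ### §3 The Mellin transform of the tail: `𝓜J(t) = t⁻¹ ∫_0^∞ xᵗ E(x) dx` -/

/-- **Mellin transform of a tail** (Fubini on `{0 < z < x}`): for `Re t > 0`,
`∫_0^∞ z^{t−1} (∫_{x>z} E(x) dx) dz = t⁻¹ ∫_0^∞ xᵗ E(x) dx`, with absolute convergence.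
[cite: KowalskiMichelVanderKam2000, (15) p. 9 and (22) p. 12] -/
theorem hasMellin_tail {c : ℝ} (hc : 0 < c) (j : ℕ) {t : ℂ} (ht : 0 < t.re) :
    MellinConvergent (fun z : ℝ ↦ ((∫ x in Ioi z, Real.exp (-x) * (Real.log c + Real.log x) ^ j : ℝ) : ℂ)) t ∧
    mellin (fun z : ℝ ↦ ((∫ x in Ioi z, Real.exp (-x) * (Real.log c + Real.log x) ^ j : ℝ) : ℂ)) t =
      t⁻¹ * ∫ x in Ioi (0 : ℝ), (x : ℂ) ^ t *
        ((Real.exp (-x) * (Real.log c + Real.log x) ^ j : ℝ) : ℂ) := by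
  set E : ℝ → ℝ := fun x : ℝ ↦ Real.exp (-x) * (Real.log c + Real.log x) ^ j with hE
  have hint : IntegrableOn E (Ioi 0) := integrableOn_expLogPow hc j
  have ht1 : -1 < (t - 1).re := by simp; linarith
  have htσ : -1 < t.re - 1 := by linarith
  have ht0 : t ≠ 0 := by intro h; rw [h] at ht; simp at ht
  -- the two-variable integrand on `(0,∞)²`: `G(z, x) = 1_{z < x} z^{t−1} E(x)`
  set G : ℝ × ℝ → ℂ := fun p ↦ {p : ℝ × ℝ | p.1 < p.2}.indicator
    (fun p ↦ (p.1 : ℂ) ^ (t - 1) * ((E p.2 : ℝ) : ℂ)) p with hG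
  have hmeas : AEStronglyMeasurable G
      ((volume.restrict (Ioi (0 : ℝ))).prod (volume.restrict (Ioi (0 : ℝ)))) := by
    rw [Measure.prod_restrict, ← Measure.volume_eq_prod]
    refine (AEStronglyMeasurable.indicator ?_ (measurableSet_lt measurable_fst measurable_snd))
    refine ContinuousOn.aestronglyMeasurable (fun p hp ↦ ?_) (measurableSet_Ioi.prod measurableSet_Ioi)
    have hp1 : (0 : ℝ) < p.1 := hp.1
    have hp2 : (0 : ℝ) < p.2 := hp.2
    refine ContinuousAt.continuousWithinAt (ContinuousAt.mul ?_ ?_)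
    · exact (continuousAt_ofReal_cpow_const p.1 (t - 1) (Or.inr hp1.ne')).comp
        continuous_fst.continuousAt
    · exact (Complex.continuous_ofReal.continuousAt.comp
        ((continuousOn_expLogPow c j).continuousAt (Ioi_mem_nhds hp2))).comp continuous_snd.continuousAt
  -- pointwise description and sections in `z` for fixed `x > 0`
  have hGpt : ∀ z x : ℝ, G (z, x) = if z < x then (z : ℂ) ^ (t - 1) * ((E x : ℝ) : ℂ) else 0 := by
    intro z x
    simp only [hG, Set.indicator_apply, Set.mem_setOf_eq]
  -- integral of a section: `E(x) x^t / t`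
  have hsec_int : ∀ x : ℝ, 0 < x →
      ∫ z in Ioi (0 : ℝ), G (z, x) = ((E x : ℝ) : ℂ) * ((x : ℂ) ^ t / t) := by
    intro x hx
    calc ∫ z in Ioi (0 : ℝ), G (z, x)
        = ∫ z in Ioi (0 : ℝ), (Iio x).indicator (fun z : ℝ ↦ (z : ℂ) ^ (t - 1) * ((E x : ℝ) : ℂ)) z :=
          setIntegral_congr_fun measurableSet_Ioi fun z _ ↦ by
            rw [hGpt]; simp only [Set.indicator_apply, Set.mem_Iio]
      _ = ∫ z in Ioo (0 : ℝ) x, (z : ℂ) ^ (t - 1) * ((E x : ℝ) : ℂ) := by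
          rw [setIntegral_indicator measurableSet_Iio, Set.Ioi_inter_Iio]
      _ = (∫ z in (0 : ℝ)..x, (z : ℂ) ^ (t - 1)) * ((E x : ℝ) : ℂ) := by
          rw [integral_mul_const, intervalIntegral.integral_of_le hx.le, integral_Ioc_eq_integral_Ioo]
      _ = ((E x : ℝ) : ℂ) * ((x : ℂ) ^ t / t) := by
          rw [integral_cpow (Or.inl ht1), sub_add_cancel, Complex.ofReal_zero,
            Complex.zero_cpow ht0, sub_zero, mul_comm]
  -- norm of a section: `|E(x)| x^σ / σ`, `σ = Re t`
  have hsec_norm : ∀ x : ℝ, 0 < x →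
      ∫ z in Ioi (0 : ℝ), ‖G (z, x)‖ = |E x| * (x ^ t.re / t.re) := by
    intro x hx
    calc ∫ z in Ioi (0 : ℝ), ‖G (z, x)‖
        = ∫ z in Ioi (0 : ℝ), (Iio x).indicator (fun z : ℝ ↦ z ^ (t.re - 1) * |E x|) z := by
          refine setIntegral_congr_fun measurableSet_Ioi fun z hz ↦ ?_
          have hz0 : (0 : ℝ) < z := hz
          rw [hGpt]
          by_cases h : z < x
          · rw [if_pos h, Set.indicator_of_mem (show z ∈ Iio x from h), norm_mul,
              Complex.norm_cpow_eq_rpow_re_of_pos hz0, Complex.norm_real, Real.norm_eq_abs, sub_re,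
              one_re]
          · rw [if_neg h, Set.indicator_of_notMem (show z ∉ Iio x from h), norm_zero]
      _ = ∫ z in Ioo (0 : ℝ) x, z ^ (t.re - 1) * |E x| := by
          rw [setIntegral_indicator measurableSet_Iio, Set.Ioi_inter_Iio]
      _ = (∫ z in (0 : ℝ)..x, z ^ (t.re - 1)) * |E x| := by
          rw [integral_mul_const, intervalIntegral.integral_of_le hx.le, integral_Ioc_eq_integral_Ioo]
      _ = |E x| * (x ^ t.re / t.re) := by
          rw [integral_rpow (Or.inl htσ), sub_add_cancel, Real.zero_rpow (ne_of_gt ht), sub_zero,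
            mul_comm]
  -- integrability of the sections and of the section norms
  have hsec_integrable : ∀ x : ℝ, 0 < x → Integrable (fun z : ℝ ↦ G (z, x)) (volume.restrict (Ioi 0)) := by
    intro x hx
    have h1 : IntegrableOn (fun z : ℝ ↦ (z : ℂ) ^ (t - 1) * ((E x : ℝ) : ℂ)) (Ioo 0 x) :=
      ((intervalIntegral.integrableOn_Ioo_cpow_iff hx).mpr ht1).mul_const _
    have h2 : IntegrableOn ((Iio x).indicator (fun z : ℝ ↦ (z : ℂ) ^ (t - 1) * ((E x : ℝ) : ℂ)))
        (Ioi 0) := by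
      rw [IntegrableOn, integrable_indicator_iff measurableSet_Iio, IntegrableOn,
        Measure.restrict_restrict measurableSet_Iio, Set.Iio_inter_Ioi]
      exact h1
    refine h2.congr_fun (fun z _ ↦ ?_) measurableSet_Ioi
    rw [hGpt]; simp only [Set.indicator_apply, Set.mem_Iio]
  have hnorm_integrable : Integrable (fun x : ℝ ↦ ∫ z in Ioi (0 : ℝ), ‖G (z, x)‖)
      (volume.restrict (Ioi 0)) := by
    have h := (integrableOn_rpow_mul_expLogPow hc j (σ := t.re) (by linarith)).div_const t.re
    refine IntegrableOn.congr_fun h (fun x hx ↦ ?_) measurableSet_Ioi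
    rw [hsec_norm x hx]
    simp only [hE]
    rw [abs_mul, abs_of_pos (Real.exp_pos _), abs_pow]
    ring
  have hGint : Integrable G ((volume.restrict (Ioi (0 : ℝ))).prod (volume.restrict (Ioi (0 : ℝ)))) := by
    refine (integrable_prod_iff' hmeas).mpr ⟨?_, hnorm_integrable⟩
    exact (ae_restrict_iff' measurableSet_Ioi).mpr (ae_of_all _ fun x hx ↦ hsec_integrable x hx)
  -- the Mellin integrand is the `z`-section integral of `G`
  have hinner : ∀ z ∈ Ioi (0 : ℝ), (z : ℂ) ^ (t - 1) • (((∫ x in Ioi z, E x : ℝ)) : ℂ) =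
      ∫ x in Ioi (0 : ℝ), G (z, x) := by
    intro z hz
    have hz0 : (0 : ℝ) < z := hz
    rw [smul_eq_mul, ← integral_complex_ofReal, ← integral_const_mul]
    have hset : Ioi z = Ioi 0 ∩ Ioi z := by
      rw [Set.Ioi_inter_Ioi, sup_eq_right.mpr hz0.le]
    rw [hset, ← setIntegral_indicator measurableSet_Ioi]
    refine setIntegral_congr_fun measurableSet_Ioi fun x _ ↦ ?_
    rw [hGpt]
    simp only [Set.indicator_apply, Set.mem_Ioi]
  constructor
  · -- absolute convergence: the `z`-section integrals of `G` form an integrable function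
    rw [MellinConvergent, IntegrableOn]
    refine (hGint.integral_prod_left).congr ?_
    exact (ae_restrict_iff' measurableSet_Ioi).mpr (ae_of_all _ fun z hz ↦ (hinner z hz).symm)
  · rw [mellin, setIntegral_congr_fun measurableSet_Ioi hinner,
      integral_integral_swap (f := fun z x ↦ G (z, x)) hGint,
      setIntegral_congr_fun measurableSet_Ioi (fun x hx ↦ hsec_int x hx), ← integral_const_mul]
    refine setIntegral_congr_fun measurableSet_Ioi fun x _ ↦ ?_
    rw [div_eq_mul_inv]
    ring

/-! ### §4 The scaled tail `Ψ(v) = J(v/c)` has Mellin transform `D_j(q̂; n, t)/t` -/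

/-- For `q̂ > 0`, `n ≥ 1`, `c = q̂/n`, `Re t > 0`: the scaled tail `Ψ(v) = ∫_{x > v/c} e^{−x}(log c + log x)^j dx`
converges absolutely in the Mellin sense at `t` and `𝓜Ψ(t) = D_j(q̂; n, t)/t`
(`𝓜Ψ(t) = cᵗ 𝓜J(t) = cᵗ t⁻¹ ∫ xᵗ E = D_j(t)/t` by `afeKernel_eq_cpow_mul_integral`).
[cite: KowalskiMichelVanderKam2000, (15) p. 9 and (22) p. 12] -/
theorem hasMellin_scaledTail {qh : ℝ} (hqh : 0 < qh) {n : ℕ} (hn : n ≠ 0) (j : ℕ) {t : ℂ}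
    (ht : 0 < t.re) :
    MellinConvergent (fun v : ℝ ↦ ((∫ x in Ioi ((qh / n)⁻¹ * v),
        Real.exp (-x) * (Real.log (qh / n) + Real.log x) ^ j : ℝ) : ℂ)) t ∧
    mellin (fun v : ℝ ↦ ((∫ x in Ioi ((qh / n)⁻¹ * v),
        Real.exp (-x) * (Real.log (qh / n) + Real.log x) ^ j : ℝ) : ℂ)) t = afeKernel qh j n t / t := by
  set c : ℝ := qh / n with hc_def
  have hc : 0 < c := div_pos hqh (by exact_mod_cast Nat.pos_of_ne_zero hn)
  obtain ⟨hconv, hmel⟩ := hasMellin_tail hc j ht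
  set J : ℝ → ℂ := fun z : ℝ ↦ ((∫ x in Ioi z, Real.exp (-x) * (Real.log c + Real.log x) ^ j : ℝ) : ℂ)
    with hJ
  have hfun : (fun v : ℝ ↦ ((∫ x in Ioi (c⁻¹ * v),
      Real.exp (-x) * (Real.log c + Real.log x) ^ j : ℝ) : ℂ)) = fun v : ℝ ↦ J (c⁻¹ * v) := by
    funext v; simp only [hJ]
  rw [hfun]
  refine ⟨(MellinConvergent.comp_mul_left (inv_pos.mpr hc)).mpr hconv, ?_⟩
  have hinv : ((c⁻¹ : ℝ) : ℂ) ^ (-t) = (c : ℂ) ^ t := by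
    have harg : (c : ℂ).arg ≠ Real.pi := by
      rw [Complex.arg_ofReal_of_nonneg hc.le]; exact Real.pi_pos.ne
    rw [Complex.ofReal_inv, Complex.cpow_neg, Complex.inv_cpow _ _ harg, inv_inv]
  rw [mellin_comp_mul_left J t (inv_pos.mpr hc), hinv, smul_eq_mul, hJ, hmel,
    afeKernel_eq_cpow_mul_integral hqh hn j (by linarith : -1 < t.re), ← hc_def]
  have ht0 : t ≠ 0 := by intro h; rw [h] at ht; simp at ht
  field_simp

/-- The Mellin transform of the scaled tail is integrable along `Re t = σ > 0` (it is `D_j/t` there).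
[cite: KowalskiMichelVanderKam2000, (22) p. 12] -/
theorem verticalIntegrable_mellin_scaledTail {qh : ℝ} (hqh : 0 < qh) {n : ℕ} (hn : n ≠ 0) (j : ℕ)
    {σ : ℝ} (hσ : 0 < σ) :
    Complex.VerticalIntegrable (mellin (fun v : ℝ ↦ ((∫ x in Ioi ((qh / n)⁻¹ * v),
        Real.exp (-x) * (Real.log (qh / n) + Real.log x) ^ j : ℝ) : ℂ))) σ := by
  rw [Complex.VerticalIntegrable]
  refine (integrable_afeKernel_div_vertical hqh hn j hσ).congr (ae_of_all _ fun y ↦ ?_)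
  simp only
  rw [(hasMellin_scaledTail hqh hn j (t := (σ : ℂ) + y * I) (by simp; exact hσ)).2]

/-- The scaled tail is continuous at every `v₀ > 0`. [cite: KowalskiMichelVanderKam2000, (22) p. 12] -/
theorem continuousAt_scaledTail {qh : ℝ} (hqh : 0 < qh) {n : ℕ} (hn : n ≠ 0) (j : ℕ) {v₀ : ℝ}
    (hv₀ : 0 < v₀) :
    ContinuousAt (fun v : ℝ ↦ ((∫ x in Ioi ((qh / n)⁻¹ * v),
        Real.exp (-x) * (Real.log (qh / n) + Real.log x) ^ j : ℝ) : ℂ)) v₀ := by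
  have hc : 0 < qh / n := div_pos hqh (by exact_mod_cast Nat.pos_of_ne_zero hn)
  have h1 : ContinuousAt (fun v : ℝ ↦ (qh / n)⁻¹ * v) v₀ := by fun_prop
  have h2 := continuousAt_tail hc j (z₀ := (qh / n)⁻¹ * v₀) (by positivity)
  exact Complex.continuous_ofReal.continuousAt.comp (ContinuousAt.comp (g := fun z : ℝ ↦
    ∫ x in Ioi z, Real.exp (-x) * (Real.log (qh / n) + Real.log x) ^ j) h2 h1)

/-! ### §5 The bridge `afeW q̂ i j n₁ n₂ = W_{ij}(log(q̂/n₁), log(q̂/n₂); n₁n₂/q̂²)` -/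

/-- `D_i(q̂; n, t) = ∫_0^∞ (c x)ᵗ e^{−x}(log c + log x)^i dx` (`c = q̂/n`, `Re t > −1`): the kernel with the
power pulled inside. [cite: KowalskiMichelVanderKam2000, (13) p. 9] -/
theorem afeKernel_eq_integral_mul_cpow {qh : ℝ} (hqh : 0 < qh) {n : ℕ} (hn : n ≠ 0) (i : ℕ) {t : ℂ}
    (ht : -1 < t.re) :
    afeKernel qh i n t = ∫ x in Ioi (0 : ℝ), ((qh / n * x : ℝ) : ℂ) ^ t *
      ((Real.exp (-x) * (Real.log (qh / n) + Real.log x) ^ i : ℝ) : ℂ) := by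
  have hc : 0 < qh / n := div_pos hqh (by exact_mod_cast Nat.pos_of_ne_zero hn)
  rw [afeKernel_eq_cpow_mul_integral hqh hn i ht, ← integral_const_mul]
  refine setIntegral_congr_fun measurableSet_Ioi fun x hx ↦ ?_
  have hsplit : ((qh / n * x : ℝ) : ℂ) = ((qh / n : ℝ) : ℂ) * (x : ℂ) := Complex.ofReal_mul _ _
  rw [hsplit, Complex.mul_cpow_ofReal_nonneg hc.le (le_of_lt hx), mul_assoc]

/-- **KMV's all-order AFE weight in closed real form (the bridge)**: for `q̂ > 0`, `n₁, n₂ ≥ 1` and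
all orders `i, j`,
`afeW q̂ i j n₁ n₂ = (1/2πi)∫_{(3)} D_i(q̂;n₁,t) D_j(q̂;n₂,t) dt/t = W_{ij}(log(q̂/n₁), log(q̂/n₂); n₁n₂/q̂²)`,
`W_{ij} = KMV2000.logCutoffW i j` (Fubini in `x₁`, then Mellin inversion of the scaled tail on `Re t = 3`).
At `i = j = 0` this is `afeW_zero_zero_eq_cutoffW`. [cite: KowalskiMichelVanderKam2000, (21)–(22) p. 12] -/
theorem afeW_eq_logCutoffW {qh : ℝ} (hqh : 0 < qh) (i j : ℕ) {n₁ n₂ : ℕ} (hn₁ : n₁ ≠ 0) (hn₂ : n₂ ≠ 0) :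
    afeW qh i j n₁ n₂ =
      ((logCutoffW i j (Real.log (qh / n₁)) (Real.log (qh / n₂)) ((n₁ : ℝ) * n₂ / qh ^ 2) : ℝ) : ℂ) := by
  set c₁ : ℝ := qh / n₁ with hc₁_def
  set c₂ : ℝ := qh / n₂ with hc₂_def
  have hn₁' : (0 : ℝ) < n₁ := by exact_mod_cast Nat.pos_of_ne_zero hn₁
  have hn₂' : (0 : ℝ) < n₂ := by exact_mod_cast Nat.pos_of_ne_zero hn₂
  have hc₁ : 0 < c₁ := div_pos hqh hn₁'
  have hc₂ : 0 < c₂ := div_pos hqh hn₂'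
  set y₀ : ℝ := (n₁ : ℝ) * n₂ / qh ^ 2 with hy₀_def
  have hy₀ : 0 < y₀ := by positivity
  have hy₀' : y₀ = (c₁ * c₂)⁻¹ := by
    rw [hy₀_def, hc₁_def, hc₂_def]; field_simp
  -- the players
  set E₁ : ℝ → ℝ := fun x ↦ Real.exp (-x) * (Real.log c₁ + Real.log x) ^ i with hE₁
  set Ψ₂ : ℝ → ℂ := fun v : ℝ ↦ ((∫ x in Ioi (c₂⁻¹ * v),
    Real.exp (-x) * (Real.log c₂ + Real.log x) ^ j : ℝ) : ℂ) with hΨ₂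
  have hσ3 : (0 : ℝ) < 3 := by norm_num
  have h3 : ((3 : ℝ) : ℂ) = (3 : ℂ) := by norm_num
  -- the vertical factor `K(y) = D_j(q̂;n₂,3+iy)/(3+iy) = 𝓜Ψ₂(3+iy)`
  set K : ℝ → ℂ := fun y ↦ afeKernel qh j n₂ (3 + y * I) / (3 + y * I) with hK
  have hKΨ : ∀ y : ℝ, mellin Ψ₂ ((3 : ℂ) + y * I) = K y := fun y ↦
    (hasMellin_scaledTail hqh hn₂ j (t := (3 : ℂ) + y * I) (by norm_num)).2
  have hKint : Integrable K := integrable_afeKernel_div_vertical hqh hn₂ j hσ3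
  have hKcont : Continuous K := by
    refine (continuous_afeKernel_vertical hqh hn₂ j (by norm_num : (-1 : ℝ) < 3)).div (by fun_prop)
      fun y h ↦ ?_
    have := congrArg Complex.re h
    norm_num at this
  -- Step 1: the integrand of `afeW` is `(∫ (c₁x₁)ᵗ E₁ dx₁) · K(y)` on `t = 3 + iy`
  have hstep1 : ∀ y : ℝ, afeKernel qh i n₁ (3 + y * I) * afeKernel qh j n₂ (3 + y * I) / (3 + y * I) =
      ∫ x₁ in Ioi (0 : ℝ), ((c₁ * x₁ : ℝ) : ℂ) ^ ((3 : ℂ) + y * I) * ((E₁ x₁ : ℝ) : ℂ) * K y := by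
    intro y
    have ht : -1 < ((3 : ℂ) + y * I).re := by norm_num
    rw [mul_div_assoc, afeKernel_eq_integral_mul_cpow hqh hn₁ i ht, ← integral_mul_const]
  -- Step 2: Fubini for `H(y, x₁) = (c₁x₁)^{3+iy} E₁(x₁) K(y)` on `ℝ × (0,∞)`
  set H : ℝ → ℝ → ℂ := fun y x₁ ↦ ((c₁ * x₁ : ℝ) : ℂ) ^ ((3 : ℂ) + y * I) * ((E₁ x₁ : ℝ) : ℂ) * K y
    with hH
  have hμ : (volume : Measure ℝ).prod (volume.restrict (Ioi (0 : ℝ))) =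
      (volume.prod volume).restrict (univ ×ˢ Ioi (0 : ℝ)) := by
    have h := Measure.prod_restrict (μ := (volume : Measure ℝ)) (ν := (volume : Measure ℝ))
      (univ : Set ℝ) (Ioi (0 : ℝ))
    rwa [Measure.restrict_univ] at h
  have hHmeas : AEStronglyMeasurable (Function.uncurry H)
      ((volume : Measure ℝ).prod (volume.restrict (Ioi (0 : ℝ)))) := by
    rw [hμ, ← Measure.volume_eq_prod]
    refine ContinuousOn.aestronglyMeasurable (fun p hp ↦ ?_) (MeasurableSet.univ.prod measurableSet_Ioi)
    have hp2 : (0 : ℝ) < p.2 := hp.2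
    have hbase : ((c₁ * p.2 : ℝ) : ℂ) ∈ Complex.slitPlane :=
      Complex.ofReal_mem_slitPlane.mpr (mul_pos hc₁ hp2)
    refine ContinuousAt.continuousWithinAt ?_
    simp only [Function.uncurry_def, hH]
    refine ContinuousAt.mul (ContinuousAt.mul ?_ ?_) (hKcont.continuousAt.comp continuous_fst.continuousAt)
    · have h1 : ContinuousAt (fun p : ℝ × ℝ ↦ (((c₁ * p.2 : ℝ) : ℂ), ((3 : ℂ) + p.1 * I))) p := by
        fun_prop
      exact (continuousAt_cpow hbase).comp h1
    · exact (Complex.continuous_ofReal.continuousAt.comp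
        ((continuousOn_expLogPow c₁ i).continuousAt (Ioi_mem_nhds hp2))).comp
        continuous_snd.continuousAt
  have hHint : Integrable (Function.uncurry H) ((volume : Measure ℝ).prod (volume.restrict (Ioi (0 : ℝ)))) := by
    -- dominated by `‖K(y)‖ · (c₁^3 x₁^3 |E₁(x₁)|)`
    have hX : Integrable (fun x₁ : ℝ ↦ c₁ ^ (3 : ℝ) * (x₁ ^ (3 : ℝ) *
        (Real.exp (-x₁) * |Real.log c₁ + Real.log x₁| ^ i))) (volume.restrict (Ioi (0 : ℝ))) :=
      (integrableOn_rpow_mul_expLogPow hc₁ i (σ := 3) (by norm_num)).const_mul _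
    have hdom := hKint.norm.mul_prod hX
    refine Integrable.mono' hdom hHmeas ?_
    rw [hμ]
    refine (ae_restrict_iff' (MeasurableSet.univ.prod measurableSet_Ioi)).mpr (ae_of_all _ fun p hp ↦ ?_)
    have hp2 : (0 : ℝ) < p.2 := hp.2
    have hcp : 0 < c₁ * p.2 := mul_pos hc₁ hp2
    simp only [Function.uncurry_def, hH, hE₁]
    rw [norm_mul, norm_mul, Complex.norm_cpow_eq_rpow_re_of_pos hcp, Complex.norm_real, Real.norm_eq_abs,
      abs_mul, abs_of_pos (Real.exp_pos _), abs_pow, Real.mul_rpow hc₁.le hp2.le]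
    simp only [add_re, mul_re, I_re, I_im, ofReal_re, ofReal_im]
    norm_num
    apply le_of_eq
    ring
  -- Step 3: swap the integrals
  have hswap : ∫ y : ℝ, ∫ x₁ in Ioi (0 : ℝ), H y x₁ = ∫ x₁ in Ioi (0 : ℝ), ∫ y : ℝ, H y x₁ :=
    integral_integral_swap hHint
  -- Step 4: the inner `y`-integral is `2π E₁(x₁) Ψ₂(1/(c₁x₁))` (Mellin inversion of `Ψ₂` on `Re t = 3`)
  have hconvΨ : MellinConvergent Ψ₂ ((3 : ℝ) : ℂ) :=
    (hasMellin_scaledTail hqh hn₂ j (t := ((3 : ℝ) : ℂ)) (by norm_num)).1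
  have hvertΨ : Complex.VerticalIntegrable (mellin Ψ₂) 3 := verticalIntegrable_mellin_scaledTail hqh hn₂ j hσ3
  have hinner : ∀ x₁ : ℝ, 0 < x₁ →
      ∫ y : ℝ, H y x₁ = 2 * π * ((E₁ x₁ : ℝ) : ℂ) * Ψ₂ ((c₁ * x₁)⁻¹) := by
    intro x₁ hx₁
    have hcx : 0 < c₁ * x₁ := mul_pos hc₁ hx₁
    have hinvM := mellinInv_mellin_eq 3 Ψ₂ (inv_pos.mpr hcx) hconvΨ hvertΨ
      (continuousAt_scaledTail hqh hn₂ j (inv_pos.mpr hcx))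
    -- `((c₁x₁)⁻¹)^{−(3+iy)} = (c₁x₁)^{3+iy}`
    have hpow : ∀ y : ℝ, (((c₁ * x₁)⁻¹ : ℝ) : ℂ) ^ (-(((3 : ℝ) : ℂ) + y * I)) =
        ((c₁ * x₁ : ℝ) : ℂ) ^ ((3 : ℂ) + y * I) := by
      intro y
      have harg : ((c₁ * x₁ : ℝ) : ℂ).arg ≠ Real.pi := by
        rw [Complex.arg_ofReal_of_nonneg hcx.le]; exact Real.pi_pos.ne
      rw [Complex.ofReal_inv, Complex.cpow_neg, Complex.inv_cpow _ _ harg, inv_inv, h3]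
    have hI : ∫ y : ℝ, H y x₁ = ((E₁ x₁ : ℝ) : ℂ) *
        ∫ y : ℝ, (((c₁ * x₁)⁻¹ : ℝ) : ℂ) ^ (-(((3 : ℝ) : ℂ) + y * I)) • mellin Ψ₂ (((3 : ℝ) : ℂ) + y * I) := by
      rw [← integral_const_mul]
      refine integral_congr_ae (ae_of_all _ fun y ↦ ?_)
      simp only [hH, smul_eq_mul]
      rw [hpow y, h3, hKΨ y]
      ring
    rw [hI]
    rw [mellinInv] at hinvM
    -- `hinvM : (1/(2π)) • ∫ … = Ψ₂ ((c₁x₁)⁻¹)`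
    have h2π : (2 * π : ℝ) ≠ 0 := by positivity
    have hint_eq : ∫ y : ℝ, (((c₁ * x₁)⁻¹ : ℝ) : ℂ) ^ (-(((3 : ℝ) : ℂ) + y * I)) •
        mellin Ψ₂ (((3 : ℝ) : ℂ) + y * I) = (2 * π : ℝ) • Ψ₂ ((c₁ * x₁)⁻¹) := by
      rw [← hinvM, smul_smul, mul_one_div_cancel h2π, one_smul]
    rw [hint_eq, Complex.real_smul]
    push_cast
    ring
  -- Step 5: `Ψ₂(1/(c₁x₁)) = ∫_{x₂ > y₀/x₁} E₂`
  have hΨval : ∀ x₁ : ℝ, 0 < x₁ → Ψ₂ ((c₁ * x₁)⁻¹) =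
      ((∫ x₂ in Ioi (y₀ / x₁), Real.exp (-x₂) * (Real.log c₂ + Real.log x₂) ^ j : ℝ) : ℂ) := by
    intro x₁ hx₁
    have harg : c₂⁻¹ * (c₁ * x₁)⁻¹ = y₀ / x₁ := by
      rw [hy₀']
      field_simp
    simp only [hΨ₂, harg]
  -- Step 6: assemble
  calc afeW qh i j n₁ n₂
      = (1 / (2 * π) : ℂ) * ∫ y : ℝ, ∫ x₁ in Ioi (0 : ℝ), H y x₁ := by
        rw [afeW]
        congr 1
        exact integral_congr_ae (ae_of_all _ fun y ↦ hstep1 y)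
    _ = (1 / (2 * π) : ℂ) * ∫ x₁ in Ioi (0 : ℝ), ∫ y : ℝ, H y x₁ := by rw [hswap]
    _ = (1 / (2 * π) : ℂ) * ∫ x₁ in Ioi (0 : ℝ), 2 * π * (((E₁ x₁ : ℝ) : ℂ) *
          ((∫ x₂ in Ioi (y₀ / x₁), Real.exp (-x₂) * (Real.log c₂ + Real.log x₂) ^ j : ℝ) : ℂ)) := by
        congr 1
        refine setIntegral_congr_fun measurableSet_Ioi fun x₁ hx₁ ↦ ?_
        rw [hinner x₁ hx₁, hΨval x₁ hx₁]
        ring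
    _ = ∫ x₁ in Ioi (0 : ℝ), ((E₁ x₁ : ℝ) : ℂ) *
          ((∫ x₂ in Ioi (y₀ / x₁), Real.exp (-x₂) * (Real.log c₂ + Real.log x₂) ^ j : ℝ) : ℂ) := by
        rw [integral_const_mul, ← mul_assoc]
        have hπ : (π : ℂ) ≠ 0 := by exact_mod_cast Real.pi_pos.ne'
        field_simp
    _ = ((logCutoffW i j (Real.log (qh / n₁)) (Real.log (qh / n₂)) ((n₁ : ℝ) * n₂ / qh ^ 2) : ℝ) : ℂ) := by
        rw [logCutoffW, ← integral_complex_ofReal]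
        refine setIntegral_congr_fun measurableSet_Ioi fun x₁ _ ↦ ?_
        simp only [hE₁, hc₁_def, hc₂_def, hy₀_def]
        push_cast
        ring

/-- Stub **T3** of the fact skeleton `log-fricke-split` (crux workfile
`Cruxes/BeyondDiagonalBeatsQuarter/Lines/log_fricke_split.lean` on stmt-Parity-20343), in its registered
quantifier shape. [cite: KowalskiMichelVanderKam2000, (21)–(22) p. 12] -/
theorem afeW_eq_logCutoffW_all :
    ∀ (qh : ℝ), 0 < qh → ∀ (i j n₁ n₂ : ℕ), n₁ ≠ 0 → n₂ ≠ 0 →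
      KMV2000.afeW qh i j n₁ n₂ =
        ((KMV2000.logCutoffW i j (Real.log (qh / n₁)) (Real.log (qh / n₂))
          ((n₁ : ℝ) * n₂ / qh ^ 2) : ℝ) : ℂ) :=
  fun _ hqh i j _ _ hn₁ hn₂ ↦ afeW_eq_logCutoffW hqh i j hn₁ hn₂

end Literature.NumberTheory.LFunctions.KMV2000

end
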